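import Literature.Topology.PlanarFoliations.LineLeafLoops
import Literature.Topology.PlanarFoliations.StabilityBand
import Literature.Topology.PlanarFoliations.Transversals
import Literature.Topology.PlaneTopology.LoopWinding
import Literature.Topology.FourManifolds.TautFoliationsLeafHeights
import Mathlib.Topology.Algebra.Module.Cardinality
import HarnessLib

/-!
# Loops tracked in an open leaf do not wind; generic chart heights off a leaf

Topic: Topology / PlanarFoliations, sequel to `LineLeafLoops.lean` (loops of open leaves are
null-homotopic in the leaf topology) and `PlaneTopology/LoopWinding.lean`. Two small tools for the
no-spiral lemma of separatrix graphs: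

* `wind_eq_zero_of_loop_in_open_leaf` (**proved**): a loop `c : I → X`, continuous in the leaf
  topology and running in an **open** leaf `L`, has planar image `ι ∘ c` of winding number `0`
  about every point off `ι(L)`.
* `exists_heights_not_mem_leafHeights` (**proved**): for a leaf `L` and a chart `e`, a height
  `h₀` and `r > 0`, there is `ρ ∈ (0, r)` with both chart heights `h₀ ± ρ` not leaf heights of
  `L` (the leaf heights are countable, `Foliation.countable_leafHeights`), i.e. the two chart
  points `e⁻¹(c, h₀ ± ρ)` are off `L`.

All statements are [folklore].
-/

noncomputable section

open Set Function unitInterval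
open _root_.Topology
open Literature.Topology.FourManifolds Literature.Topology.FourManifolds.Foliation Literature.Topology.PlaneTopology

namespace Literature.Topology.PlanarFoliations

variable {X : Type*} [TopologicalSpace X] [T2Space X] [SecondCountableTopology X] {F : Foliation ℝ X} {ι : X → ℂ}

/-- **The planar image of a loop tracked in an open leaf has winding number `0`** about every
point off the image of the leaf. [folklore] -/
theorem wind_eq_zero_of_loop_in_open_leaf (hbi : IsBiOriented F) (hιc : Continuous ι) {y : X}
    (hL : ¬ IsCompact (F.leaf y)) {c : I → X} (hc : Continuous (toLeafSpace ∘ c : I → F.LeafSpace))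
    (hc0 : c 0 ∈ F.leaf y) (hc1 : c 1 = c 0) {p : ℂ} (hp : ∀ z ∈ F.leaf y, ι z ≠ p) :
    wind (fun t ↦ ι (c (projIcc 0 1 zero_le_one t)) - p) = 0 := by
  haveI : NoncompactSpace (F.Leaf y) := noncompactSpace_leaf_of_not_isCompact hL
  have hleaf : F.leaf (c 0) = F.leaf y := leaf_eq_of_mem hc0
  have hmem : ∀ θ, c θ ∈ F.leaf y := fun θ ↦ hleaf ▸ F.mem_leaf_of_continuous_toLeafSpace hc 0 θ
  -- the loop in the leaf topology
  set p₀ : F.Leaf y := Leaf.mk (c 0) hc0 with hp₀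
  have hδc : Continuous fun θ : I ↦ (Leaf.mk (c θ) (hmem θ) : F.Leaf y) := hc.subtype_mk fun θ ↦ hmem θ
  have h1 : (Leaf.mk (c 1) (hmem 1) : F.Leaf y) = p₀ := by
    apply Subtype.ext
    show toLeafSpace (c 1) = toLeafSpace (c 0)
    rw [hc1]
  set cL : Path p₀ p₀ :=
    { toFun := fun θ ↦ Leaf.mk (c θ) (hmem θ)
      continuous_toFun := hδc
      source' := rfl
      target' := h1 } with hcL
  have hnull : cL.Homotopic (Path.refl p₀) := homotopic_refl_of_noncompactSpace hbi cL
  have hΦ : Continuous fun q : F.Leaf y ↦ ι (Leaf.pt q) := hιc.comp (Leaf.continuous_coe F y)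
  have h := wind_pathLoop_eq_zero_of_homotopic_refl hΦ hnull (p := p) fun q ↦ hp _ q.2
  have heq : (fun t ↦ pathLoop (fun q : F.Leaf y ↦ ι (Leaf.pt q)) cL t - p) =
      fun t ↦ ι (c (projIcc 0 1 zero_le_one t)) - p := by
    funext t; rfl
  rw [heq] at h
  exact h

omit [T2Space X] [SecondCountableTopology X] in
/-- **Generic chart heights off a leaf**: `ρ ∈ (0, r)` with `h₀ + ρ` and `h₀ - ρ` not leaf heights
of the leaf of `y` in the chart `e`. [folklore] -/
theorem exists_heights_not_mem_leafHeights [SecondCountableTopology X] {e : OpenPartialHomeomorph X (ℝ × ℝ)} (he : e ∈ F.atlas)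
    (y : X) (h₀ : ℝ) {r : ℝ} (hr : 0 < r) :
    ∃ ρ ∈ Ioo 0 r, h₀ + ρ ∉ F.leafHeights e y ∧ h₀ - ρ ∉ F.leafHeights e y := by
  set S := F.leafHeights e y with hS
  have hcount : S.Countable := F.countable_leafHeights he y
  set C : Set ℝ := (fun t ↦ t - h₀) '' S ∪ (fun t ↦ h₀ - t) '' S with hC
  have hC' : C.Countable := (hcount.image _).union (hcount.image _)
  have hdense : Dense Cᶜ := hC'.dense_compl ℝ
  obtain ⟨ρ, hρC, hρ⟩ := hdense.exists_mem_open isOpen_Ioo (nonempty_Ioo.2 hr)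
  refine ⟨ρ, hρ, fun h ↦ hρC (Or.inl ⟨h₀ + ρ, h, by ring⟩), fun h ↦ hρC (Or.inr ⟨h₀ - ρ, h, by ring⟩)⟩

omit [T2Space X] [SecondCountableTopology X] in
/-- A chart point at a height which is not a leaf height is off the leaf. [folklore] -/
theorem image_ne_of_not_mem_leafHeights {e : OpenPartialHomeomorph X (ℝ × ℝ)} (he : e ∈ F.atlas) {y : X} {b h : ℝ}
    (hh : h ∉ F.leafHeights e y) (hι : Injective ι) : ∀ z ∈ F.leaf y, ι z ≠ ι (e.symm (b, h)) := by
  intro z hz heq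
  have hzeq : z = e.symm (b, h) := hι heq
  exact hh (F.mem_leafHeights_iff.2 ⟨z, hz, hzeq ▸ F.symm_mem_plaque he b h⟩)

end Literature.Topology.PlanarFoliations
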